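import Mathlib
import HarnessLib
import Literature.Computability.AlgebraicComplexity.PatternExpressions
import Literature.Computability.AlgebraicComplexity.ValiantClasses
import Literature.Combinatorics.SimpleGraph.TreeDecomposition
import Summits.ValiantsHypothesis.ValiantsHypothesis.Theorems.MonotoneRestorationMonotoneRestorationQPLinearWidthOrbitSeparation

/-!
# Route MonotoneRestoration, crux `MonotoneRestorationQP` (stmt-15886), line `linear-width` —
# NARROW EXPANSIONS ARE HOM-DETERMINED: K1 of line `narrow-expansion` (crux `OrbitRestorationQP`,
# stmt-18293) implies GAP 2 `HomDeterminedVP`; and the one-sorted scale is strictly finer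

Helper file (`--supports stmt-ValiantsHypothesis-15886`), def-free.  Two kernel-visible comparisons
between the registered stubs of the route's width lines, plus one strictness witness:

* `eval_eq_of_mem_narrowSpan` — a polynomial in the `ℂ`-span of the homomorphism polynomials `hom_{F,n}`
  of bipartite patterns of treewidth `≤ w` takes equal values at any two points hom-indistinguishable below
  treewidth `w + 1` (`HomIndist` of line `linear-width`, unfolded verbatim) — linearity of evaluation;
* `polylogHomDetermined_of_narrowExpansion` — hence the CONCLUSION of K1 `stub_narrowExpansionVP` of
  `Cruxes/OrbitRestorationQP/Lines/narrow_expansion.lean` for a family `f` (verbatim: `f n` lies in the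
  span of `hom_{F,n}`, `tw F ≤ (log₂ n + c)^c`) gives `PolylogHomDetermined f` of line `linear-width`
  (verbatim, exponent `c + 2`);
* `homDeterminedVP_of_narrowExpansionVP` — so K1 (the statement of `stub_narrowExpansionVP`, verbatim)
  implies GAP 2 `HomDeterminedVP` (the statement of `stub_homDeterminedVP` of
  `Cruxes/MonotoneRestorationQP/Lines/linear_width.lean`, verbatim): K1 is at least summit-strength in
  counting-width currency, and an on-path certificate `OrbitRestorationQP → K1` would certify GAP 2 too
  (both are the support-theorem direction; neither is in the tree);
* `exists_homIndist_all_ne_trace` — STRICTNESS OF THE ONE-SORTED SCALE: at level `n = 2` there are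
  points `A, B` agreeing on ALL bipartite homomorphism polynomials (indeed `B` is a column permutation of
  `A`) at which the square-symmetric trace `x₀₀ + x₁₁` takes different values — so square-symmetric gate
  values of the route's circuits are NOT determined by the two-sorted `HomIndist` scale of line
  `linear-width`, only by the directed scale of `Theorems/…OrbitCompressionQPDiOrbitSeparation.lean`
  (the determination-currency form of the trace witness of `Theorems/…OrbitToNarrowExpressionFalse.lean`).

Honest label: bookkeeping between registered stubs + a two-point witness; no stub closed; VP ≠ VNP not
moved. [cite: DwivediPagoSeppelt2026, Def. 3.2 and Cor. 3.3]
-/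

-- `Summit.ValiantsHypothesis.ValiantsHypothesis.…` is the tree's mandated namespace (Sub = Summit).
set_option linter.dupNamespace false

noncomputable section

namespace Summit.ValiantsHypothesis.ValiantsHypothesis.Theorems

namespace NarrowDetermined

open Literature.Computability.AlgebraicComplexity MvPolynomial

variable {n : ℕ}

/-! ### Narrow span ⇒ determined below the same treewidth -/

/-- **Evaluation is linear**: if two points agree on a set of polynomials they agree on its span.
[folklore] -/
theorem eval_eq_of_mem_span {S : Set (MvPolynomial (Fin n × Fin n) ℂ)} {A B : Fin n × Fin n → ℂ}
    (hS : ∀ q ∈ S, eval A q = eval B q) {p : MvPolynomial (Fin n × Fin n) ℂ}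
    (hp : p ∈ Submodule.span ℂ S) : eval A p = eval B p := by
  refine Submodule.span_induction (p := fun r _ => eval A r = eval B r) (fun q hq => hS q hq) (by simp)
    (fun x y _ _ hx hy => by simp [hx, hy]) (fun c x _ hx => by simp [hx]) hp

/-- **Narrow expansions are hom-determined below the same width.**  A polynomial in the span of the
`hom_{F,n}` with `tw F ≤ w` takes equal values at points hom-indistinguishable below treewidth `k > w`
(`HomIndist n k`, unfolded verbatim). [cite: DwivediPagoSeppelt2026, Def. 3.2] -/
theorem eval_eq_of_mem_narrowSpan {w k : ℕ} (hwk : w < k) {p : MvPolynomial (Fin n × Fin n) ℂ}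
    (hp : p ∈ Submodule.span ℂ
      {q : MvPolynomial (Fin n × Fin n) ℂ | ∃ (a b : ℕ) (E : Multiset (Fin a × Fin b)),
        Literature.Combinatorics.SimpleGraph.treewidth
            (SimpleGraph.fromRel fun u v : Fin a ⊕ Fin b =>
              ∃ e ∈ E, u = Sum.inl e.1 ∧ v = Sum.inr e.2) ≤ w ∧
          q = homPoly E n ℂ})
    (A B : Fin n × Fin n → ℂ)
    (hind : ∀ (a b : ℕ) (E : Multiset (Fin a × Fin b)),
      Literature.Combinatorics.SimpleGraph.treewidth
        (SimpleGraph.fromRel fun u v : Fin a ⊕ Fin b => ∃ p ∈ E, u = Sum.inl p.1 ∧ v = Sum.inr p.2) < k →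
      eval A (homPoly E n ℂ) = eval B (homPoly E n ℂ)) :
    eval A p = eval B p := by
  refine eval_eq_of_mem_span (fun q hq => ?_) hp
  obtain ⟨a, b, E, hE, rfl⟩ := hq
  exact hind a b E (hE.trans_lt hwk)

/-- Exponent arithmetic: `(L + c)^c < (L + (c + 2))^(c + 2)`. [folklore] -/
theorem pow_lt_pow_add_two (L c : ℕ) : (L + c) ^ c < (L + (c + 2)) ^ (c + 2) := by
  have h1 : (L + c) ^ c ≤ (L + (c + 2)) ^ c := Nat.pow_le_pow_left (by omega) c
  have h2 : 1 ≤ (L + c) ^ c := by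
    rcases Nat.eq_zero_or_pos c with rfl | hc
    · simp
    · exact Nat.one_le_pow _ _ (by omega)
  have h4 : 4 ≤ (L + (c + 2)) ^ 2 :=
    calc 4 = 2 ^ 2 := by norm_num
      _ ≤ (L + (c + 2)) ^ 2 := Nat.pow_le_pow_left (by omega) 2
  calc (L + c) ^ c < (L + c) ^ c * 4 := by omega
    _ ≤ (L + (c + 2)) ^ c * (L + (c + 2)) ^ 2 := Nat.mul_le_mul h1 h4
    _ = (L + (c + 2)) ^ (c + 2) := by rw [← pow_add]

/-- **K1's conclusion for a family gives `PolylogHomDetermined`** (line `linear-width`, unfolded verbatim,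
exponent `c + 2`). [cite: DwivediPagoSeppelt2026, Cor. 3.3] -/
theorem polylogHomDetermined_of_narrowExpansion (f : (n : ℕ) → MvPolynomial (Fin n × Fin n) ℂ)
    (hK1 : ∃ c : ℕ, ∀ n : ℕ, f n ∈ Submodule.span ℂ
        {p : MvPolynomial (Fin n × Fin n) ℂ | ∃ (a b : ℕ) (E : Multiset (Fin a × Fin b)),
          Literature.Combinatorics.SimpleGraph.treewidth
              (SimpleGraph.fromRel fun u v : Fin a ⊕ Fin b =>
                ∃ e ∈ E, u = Sum.inl e.1 ∧ v = Sum.inr e.2) ≤ (Nat.log 2 n + c) ^ c ∧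
            p = homPoly E n ℂ}) :
    ∃ c : ℕ, ∀ (n : ℕ) (A B : Fin n × Fin n → ℂ),
      (∀ (a b : ℕ) (E : Multiset (Fin a × Fin b)),
        Literature.Combinatorics.SimpleGraph.treewidth
          (SimpleGraph.fromRel fun u v : Fin a ⊕ Fin b => ∃ p ∈ E, u = Sum.inl p.1 ∧ v = Sum.inr p.2) <
          (Nat.log 2 n + c) ^ c →
        MvPolynomial.eval A (homPoly E n ℂ) = MvPolynomial.eval B (homPoly E n ℂ)) →
      MvPolynomial.eval A (f n) = MvPolynomial.eval B (f n) := by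
  obtain ⟨c, hc⟩ := hK1
  exact ⟨c + 2, fun n A B hind =>
    eval_eq_of_mem_narrowSpan (pow_lt_pow_add_two (Nat.log 2 n) c) (hc n) A B hind⟩

/-- **K1 ⇒ GAP 2.**  The statement of `stub_narrowExpansionVP` (line `narrow-expansion` of crux
`OrbitRestorationQP`, verbatim) implies the statement of `stub_homDeterminedVP` (`HomDeterminedVP` of line
`linear-width`, unfolded verbatim): every matrix-symmetric `VP` family is polylog-hom-determined.
[cite: DwivediPagoSeppelt2026, Cor. 3.3 and Outlook Q3] -/
theorem homDeterminedVP_of_narrowExpansionVP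
    (hK1 : ∀ f : (n : ℕ) → MvPolynomial (Fin n × Fin n) ℂ,
      (∀ (n : ℕ) (σ τ : Equiv.Perm (Fin n)),
        MvPolynomial.rename (fun p : Fin n × Fin n => (σ p.1, τ p.2)) (f n) = f n) →
      IsVPFamily f →
      ∃ c : ℕ, ∀ n : ℕ, f n ∈ Submodule.span ℂ
        {p : MvPolynomial (Fin n × Fin n) ℂ | ∃ (a b : ℕ) (E : Multiset (Fin a × Fin b)),
          Literature.Combinatorics.SimpleGraph.treewidth
              (SimpleGraph.fromRel fun u v : Fin a ⊕ Fin b =>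
                ∃ e ∈ E, u = Sum.inl e.1 ∧ v = Sum.inr e.2) ≤ (Nat.log 2 n + c) ^ c ∧
            p = homPoly E n ℂ}) :
    ∀ f : (n : ℕ) → MvPolynomial (Fin n × Fin n) ℂ,
      (∀ (n : ℕ) (σ τ : Equiv.Perm (Fin n)),
        MvPolynomial.rename (fun p : Fin n × Fin n => (σ p.1, τ p.2)) (f n) = f n) →
      IsVPFamily f →
      ∃ c : ℕ, ∀ (n : ℕ) (A B : Fin n × Fin n → ℂ),
        (∀ (a b : ℕ) (E : Multiset (Fin a × Fin b)),
          Literature.Combinatorics.SimpleGraph.treewidth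
            (SimpleGraph.fromRel fun u v : Fin a ⊕ Fin b => ∃ p ∈ E, u = Sum.inl p.1 ∧ v = Sum.inr p.2) <
            (Nat.log 2 n + c) ^ c →
          MvPolynomial.eval A (homPoly E n ℂ) = MvPolynomial.eval B (homPoly E n ℂ)) →
        MvPolynomial.eval A (f n) = MvPolynomial.eval B (f n) :=
  fun f hsymm hVP => polylogHomDetermined_of_narrowExpansion f (hK1 f hsymm hVP)

/-! ### The one-sorted scale is strictly finer than the two-sorted one -/

/-- **Bipartite hom values do not determine square-symmetric polynomials.**  At level `n = 2` the points
`A = E₀₀` and `B = E₀₁` (a column permutation of `A`) agree on every bipartite homomorphism polynomial,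
but the trace `x₀₀ + x₁₁` — a square-symmetric polynomial, the directed homomorphism polynomial of the
loop — is `1` at `A` and `0` at `B`. [folklore] -/
theorem exists_homIndist_all_ne_trace :
    ∃ A B : Fin 2 × Fin 2 → ℂ,
      (∀ (a b : ℕ) (E : Multiset (Fin a × Fin b)), eval A (homPoly E 2 ℂ) = eval B (homPoly E 2 ℂ)) ∧
      eval A (∑ i : Fin 2, (X (i, i) : MvPolynomial (Fin 2 × Fin 2) ℂ)) ≠
        eval B (∑ i : Fin 2, (X (i, i) : MvPolynomial (Fin 2 × Fin 2) ℂ)) := by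
  let A : Fin 2 × Fin 2 → ℂ := fun ij => if ij = (0, 0) then 1 else 0
  refine ⟨A, fun ij => A (ij.1, Equiv.swap (0 : Fin 2) 1 ij.2), ?_, ?_⟩
  · intro a b E
    exact ((OrbitSeparation.forall_eval_homPoly_eq_iff_exists_perms A _).2 ⟨1, Equiv.swap 0 1, rfl⟩) a b E
  · simp [A, Fin.sum_univ_two, Equiv.swap_apply_left, Equiv.swap_apply_right]

end NarrowDetermined

end Summit.ValiantsHypothesis.ValiantsHypothesis.Theorems

end
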